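import Summits.ResolutionOfSingularities.ResolutionOfSingularities.Theses.FrobeniusLadder
import Summits.ResolutionOfSingularities.ResolutionOfSingularities.Theorems.FrobeniusLadderFRationalModificationIntegralForm
import Summits.ResolutionOfSingularities.ResolutionOfSingularities.Theorems.FrobeniusLadderFRationalModificationMaxMultiplicityCertificate
import Summits.ResolutionOfSingularities.ResolutionOfSingularities.Theorems.FrobeniusLadderFRationalModificationFiniteDefectGlobal
import Literature.AlgebraicGeometry.Resolution.ComponentGluing
import Literature.AlgebraicGeometry.Resolution.AffineBlowup
import Literature.RingTheory.TightClosure.TightClosure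
import Mathlib.RingTheory.RegularLocalRing.Defs
import Mathlib.AlgebraicGeometry.Morphisms.Proper
import Mathlib.AlgebraicGeometry.Noetherian
import HarnessLib

/-!
# Line `socle-discrepancy-certificate` — lead skeleton v4 (crux `FrobeniusLadder.FRationalModification`,
stmt-ResolutionOfSingularities-15316; lead prover-line-stmt-ResolutionOfSingularities-15316-a1-0, crux cycle 10)

RESHAPE of v2L (lead c8, registered 38ba9e1c) in two steps (v3.1 registered 50d4bb89 → v4). The composition idea is
unchanged — LOCAL certificates at isolated-defect germs + GLOBALISATION — but:

* v2L's globalisation stub `stub_codimStep` (an abstract ∃-local-to-global with no method; lead c8 `promote-stub`) is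
  SPLIT into its PROVABLE finite-defect half, LANDED by this lead as `FiniteDefectGlobal.rungThreeModel_of_finiteDefect`
  (`Theorems/FrobeniusLadderFRationalModificationFiniteDefectGlobal.lean`, p160614: finite defect ⇒ defect points
  closed (F-rationality generizes, HH94 4.2 (f) + Stacks 01J7) and punctured spectra rung-3, both DERIVED; curves by
  normalisation; closed points have `dim 𝒪 = dim Y ≥ 2`; the local blow-up certificates are glued and consumed by
  `finiteBlowupRungThreeOrCertifiedDefect_model`, p157821), and the honest open GLOBAL residue `stub_isolateDefect`
  (S4°): every integral rung-2 `Y/k` has a proper birational INTEGRAL RUNG-2 model with FINITE defect whose defect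
  points are ISOLATED SINGULARITIES (implied by a resolution of `Y`: `isolatedDefectModel_of_hasResolution`);
* the local producer S2 is RE-TYPED in the blow-up form the landed globaliser consumes (lead c8's recommendation (3)):
  `stub_isolatedSingularityBlowupCertificate` (S2') — `∃ I ⊆ 𝔪_R` `𝔪_R`-primary with `affineBlowup I` pointwise
  rung-3 OR certified, for an isolated singularity of dimension ≥ 2 (the bound is supplied by the composition) that is
  not a maximal-multiplicity F-pure hypersurface; S1 `stub_maxMultiplicityCertificate` is LANDED (p152829) and is
  exactly the case `I = 𝔪`;
* v2L's S3 / v3's S3' (isolated defect inside a positive-dimensional singular locus) is WITHDRAWN as ill-posed in the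
  blow-up form (an 𝔪-primary blow-up is an isomorphism over the singular curve, so at the points where its strict
  transform meets the exceptional fibre it demanded F-rationality that no resolution statement supplies — wave-1
  worker analysis, cycle 10); its burden moved into S4°'s isolated-singularity conjunct, which a resolution covers.

Dictionary (all predicates inline, no `def`): RUNG2/RUNG3 = the crux's stalk predicates verbatim (`Disproof.lean` §0);
CLAUSE = rung 2 without the domain conjunct; CERT = birth's pointwise certificate (`t ∈ 𝔪 ∖ 0`, `𝒪[1/t]` regular,
`𝒪/(t)` CLAUSE); GERM = "is a stalk of an integral separated finite-type scheme over a field of characteristic `p`".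

`local_blowup_model` (PROVED: case split S1 / S2') and `isRegularLocalRing_localization_of_generizations` (PROVED:
isolated singularity ⇒ regular punctured spectrum, Stacks 01J7) feed the landed `rungThreeModel_of_finiteDefect`, and
`FRationalModification_of` is sorry-free modulo the two stubs and concludes the route decl BY NAME through
`IntegralForm.fRationalModification_iff_integral` (p131587): isolate (S4°) ⇒ finite-defect globaliser ⇒ compose
(proper ∘ proper, `ComponentGluing.IsBirational.comp`).
-/

-- single-problem summit: the doubled namespace component `ResolutionOfSingularities` is forced
set_option linter.dupNamespace false

noncomputable section

open CategoryTheory AlgebraicGeometry TopologicalSpace IsLocalRing Order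
open Literature.AlgebraicGeometry.Resolution Literature.RingTheory.TightClosure
open Summit.ResolutionOfSingularities.ResolutionOfSingularities.Theses.FrobeniusLadder
open Summit.ResolutionOfSingularities.ResolutionOfSingularities.Theorems
open Summit.ResolutionOfSingularities.ResolutionOfSingularities.Theorems.FRationalModification

namespace Summit.ResolutionOfSingularities.ResolutionOfSingularities.Cruxes.FRationalModification.Lines.SocleDiscrepancyCertificate

/-- The rung-3 clause of the crux at a ring `X` (domain; every ideal generated by a system of parameters
tightly closed — inline form). -/
local notation3 "RUNG3[" p ", " X "]" => IsDomain X ∧ ∀ d : ℕ, ringKrullDim X = (d : WithBot ℕ∞) →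
  ∀ s : Fin d → X, (Ideal.radical (R := X) (Ideal.span (Set.range s))).IsMaximal → ∀ y c : X, c ≠ 0 →
    (∀ e : ℕ, c * y ^ p ^ e ∈ Ideal.span ((fun z : X => z ^ p ^ e) '' (Ideal.span (Set.range s) : Set X))) →
      y ∈ Ideal.span (Set.range s)

/-- The rung-2 clause of the crux at a ring `X` (domain; every system of parameters weakly regular and
generating a Frobenius-closed ideal — inline form). -/
local notation3 "RUNG2[" p ", " X "]" => IsDomain X ∧ ∀ d : ℕ, ringKrullDim X = (d : WithBot ℕ∞) →
  ∀ s : Fin d → X, (Ideal.radical (R := X) (Ideal.span (Set.range s))).IsMaximal →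
    RingTheory.Sequence.IsWeaklyRegular X (List.ofFn s) ∧
    ∀ y : X, (∃ e : ℕ, y ^ p ^ e ∈ Ideal.span ((fun z : X => z ^ p ^ e) '' (Ideal.span (Set.range s) : Set X))) →
      y ∈ Ideal.span (Set.range s)

/-- The Cohen–Macaulay + Frobenius-closed clause (rung 2 without the domain conjunct) at a ring `X`. -/
local notation3 "CLAUSE[" p ", " X "]" => ∀ d : ℕ, ringKrullDim X = (d : WithBot ℕ∞) → ∀ s : Fin d → X,
  (Ideal.radical (R := X) (Ideal.span (Set.range s))).IsMaximal →
    RingTheory.Sequence.IsWeaklyRegular X (List.ofFn s) ∧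
    ∀ y : X, (∃ e : ℕ, y ^ p ^ e ∈ Ideal.span ((fun z : X => z ^ p ^ e) '' (Ideal.span (Set.range s) : Set X))) →
      y ∈ Ideal.span (Set.range s)

/-- The pointwise certificate at a local ring `L`: a domain with a non-zero `t ∈ 𝔪_L`, `L[1/t]` regular and
`L/(t)` Cohen–Macaulay with Frobenius-closed parameter ideals (inline form). -/
local notation3 "CERT[" p ", " L "]" => IsDomain L ∧ ∃ t : L,
  t ∈ IsLocalRing.maximalIdeal L ∧ t ≠ 0 ∧ IsRegularRing (Localization.Away t) ∧ CLAUSE[p, L ⧸ Ideal.span {t}]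

/-! ## §0 The two registered stubs (both OPEN; each is implied by a resolution of the input) -/

/-- STUB S2' `stub_isolatedSingularityBlowupCertificate` (OPEN — the (KLT)/(LCX) residue at isolated singularities).
An isolated singularity `R` of dimension `≥ 2` that is an isolated-defect rung-2 variety germ, NOT rung-3 and NOT a
maximal-multiplicity F-pure hypersurface, has an `𝔪_R`-primary ideal `I` (weights!) whose blowing up
`affineBlowup I` is pointwise rung-3 OR certified. First test: `y²+z³+x¹²+x⁶w⁶+w¹²` over `𝔽₇` (ccc witness;
weights `(1,6,4,1)`). -/
theorem stub_isolatedSingularityBlowupCertificate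
    (p : ℕ) [Fact p.Prime] (R : Type) [CommRing R] [IsNoetherianRing R] [IsLocalRing R] [IsDomain R] [CharP
    R p] (hgerm : (∃ (k : Type) (_ : Field k) (_ : CharP k p) (Y : Scheme.{0}) (g : Y ⟶ Spec (.of k)) (_ :
    IsSeparated g) (_ : LocallyOfFiniteType g) (_ : QuasiCompact g) (_ : IsIntegral Y) (y : Y), Nonempty (R
    ≃+* Y.presheaf.stalk y))) (h₂ : (IsDomain R ∧ ∀ d : ℕ, ringKrullDim R = d → ∀ s : Fin d → R, (Ideal.span
    (Set.range s)).radical.IsMaximal → RingTheory.Sequence.IsWeaklyRegular R (List.ofFn s) ∧ ∀ u : R, (∃ e :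
    ℕ, u ^ p ^ e ∈ Ideal.span ((fun z : R => z ^ p ^ e) '' (Ideal.span (Set.range s) : Set R))) → u ∈
    Ideal.span (Set.range s))) (h₃ : ¬ (IsDomain R ∧ ∀ d : ℕ, ringKrullDim R = d → ∀ s : Fin d → R,
    (Ideal.span (Set.range s)).radical.IsMaximal → ∀ u c : R, c ≠ 0 → (∀ e : ℕ, c * u ^ p ^ e ∈ Ideal.span
    ((fun z : R => z ^ p ^ e) '' (Ideal.span (Set.range s) : Set R))) → u ∈ Ideal.span (Set.range s))) (hm :
    IsLocalRing.maximalIdeal R ≠ ⊥) (hdim : (2 : WithBot ℕ∞) ≤ ringKrullDim R) (hreg : (∀ (q : Ideal R)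
    [q.IsPrime], q ≠ IsLocalRing.maximalIdeal R → IsRegularLocalRing (Localization.AtPrime q))) (hhyp : ¬ (∃
    (S : Type) (_ : CommRing S) (_ : IsRegularLocalRing S) (_ : CharP S p) (n : ℕ) (f : S), ringKrullDim S =
    ((n + 1 : ℕ) : WithBot ℕ∞) ∧ f ∈ IsLocalRing.maximalIdeal S ^ (n + 1) ∧ f ^ (p - 1) ∉ frobeniusPower p
    (IsLocalRing.maximalIdeal S) ∧ Nonempty (R ≃+* S ⧸ Ideal.span {f}))) : (∃ I : Ideal R, I ≤
    IsLocalRing.maximalIdeal R ∧ IsLocalRing.maximalIdeal R ≤ I.radical ∧ ∀ w : affineBlowup I, (IsDomain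
    ((affineBlowup I).presheaf.stalk w) ∧ ∀ d : ℕ, ringKrullDim ((affineBlowup I).presheaf.stalk w) = d → ∀
    s : Fin d → ((affineBlowup I).presheaf.stalk w), (Ideal.span (Set.range s)).radical.IsMaximal → ∀ u c :
    ((affineBlowup I).presheaf.stalk w), c ≠ 0 → (∀ e : ℕ, c * u ^ p ^ e ∈ Ideal.span ((fun z :
    ((affineBlowup I).presheaf.stalk w) => z ^ p ^ e) '' (Ideal.span (Set.range s) : Set ((affineBlowup
    I).presheaf.stalk w)))) → u ∈ Ideal.span (Set.range s)) ∨ (IsDomain (((affineBlowup I).presheaf.stalk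
    w)) ∧ ∃ t : ((affineBlowup I).presheaf.stalk w), t ∈ IsLocalRing.maximalIdeal (((affineBlowup
    I).presheaf.stalk w)) ∧ t ≠ 0 ∧ IsRegularRing (Localization.Away t) ∧ (∀ d : ℕ, ringKrullDim
    (((affineBlowup I).presheaf.stalk w) ⧸ Ideal.span {t}) = d → ∀ s : Fin d → ((affineBlowup
    I).presheaf.stalk w) ⧸ Ideal.span {t}, (Ideal.span (Set.range s)).radical.IsMaximal →
    RingTheory.Sequence.IsWeaklyRegular (((affineBlowup I).presheaf.stalk w) ⧸ Ideal.span {t}) (List.ofFn s)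
    ∧ ∀ u : ((affineBlowup I).presheaf.stalk w) ⧸ Ideal.span {t}, (∃ e : ℕ, u ^ p ^ e ∈ Ideal.span ((fun z :
    ((affineBlowup I).presheaf.stalk w) ⧸ Ideal.span {t} => z ^ p ^ e) '' (Ideal.span (Set.range s) : Set
    (((affineBlowup I).presheaf.stalk w) ⧸ Ideal.span {t})))) → u ∈ Ideal.span (Set.range s)))) := by
  sorry

/-- STUB S4° `stub_isolateDefect` (OPEN, the global residue; held by the lead; v4 form). Every integral separated
finite-type rung-2 `Y/k` (`char k = p`) has a proper birational model `Y' → Y` that is again INTEGRAL and RUNG-2 at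
every point, whose defect (the set of non-rung-3 points) is FINITE, and whose defect points are ISOLATED
SINGULARITIES (every proper generization of a defect point has a regular local ring). F-rational singularities away
from the defect are allowed. (Implied by the summit: a resolution is integral, rung-2, regular, with empty defect —
`isolatedDefectModel_of_hasResolution`. Dimension ≤ 1: the normalisation. It contains "normalise without losing rung 2"
already for surfaces over any field, cf. Disproof §3 and the umbrella `x² = t·y²`.) The v3 form without the
isolated-singularity conjunct needed a third local stub (`stub_singularLocusBlowupCertificate`, isolated defect inside
a positive-dimensional singular locus), WITHDRAWN in v4 as ill-posed: an 𝔪-primary blow-up is an isomorphism over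
the singular curve, so at the points where its strict transform meets the exceptional fibre the stub demanded
F-rationality that no resolution statement supplies (wave-1 worker analysis); the isolated-singularity conjunct moves
that burden here, where the summit still covers it. -/
theorem stub_isolateDefect
    (p : ℕ) [Fact p.Prime] (k : Type) [Field k] [CharP k p] (Y : Scheme.{0}) (g : Y ⟶ Spec (.of k))
    [IsSeparated g] [LocallyOfFiniteType g] [QuasiCompact g] [IsIntegral Y] (h₂ : ∀ y : Y, (IsDomain
    (Y.presheaf.stalk y) ∧ ∀ d : ℕ, ringKrullDim (Y.presheaf.stalk y) = d → ∀ s : Fin d → (Y.presheaf.stalk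
    y), (Ideal.span (Set.range s)).radical.IsMaximal → RingTheory.Sequence.IsWeaklyRegular (Y.presheaf.stalk
    y) (List.ofFn s) ∧ ∀ u : (Y.presheaf.stalk y), (∃ e : ℕ, u ^ p ^ e ∈ Ideal.span ((fun z :
    (Y.presheaf.stalk y) => z ^ p ^ e) '' (Ideal.span (Set.range s) : Set (Y.presheaf.stalk y)))) → u ∈
    Ideal.span (Set.range s))) : ∃ (Y' : Scheme.{0}) (ρ : Y' ⟶ Y), IsProper ρ ∧ IsBirational ρ ∧ IsIntegral
    Y' ∧ (∀ y : Y', (IsDomain (Y'.presheaf.stalk y) ∧ ∀ d : ℕ, ringKrullDim (Y'.presheaf.stalk y) = d → ∀ s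
    : Fin d → (Y'.presheaf.stalk y), (Ideal.span (Set.range s)).radical.IsMaximal →
    RingTheory.Sequence.IsWeaklyRegular (Y'.presheaf.stalk y) (List.ofFn s) ∧ ∀ u : (Y'.presheaf.stalk y),
    (∃ e : ℕ, u ^ p ^ e ∈ Ideal.span ((fun z : (Y'.presheaf.stalk y) => z ^ p ^ e) '' (Ideal.span (Set.range
    s) : Set (Y'.presheaf.stalk y)))) → u ∈ Ideal.span (Set.range s))) ∧ {x : Y' | ¬ (IsDomain
    (Y'.presheaf.stalk x) ∧ ∀ d : ℕ, ringKrullDim (Y'.presheaf.stalk x) = d → ∀ s : Fin d →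
    (Y'.presheaf.stalk x), (Ideal.span (Set.range s)).radical.IsMaximal → ∀ u c : (Y'.presheaf.stalk x), c ≠
    0 → (∀ e : ℕ, c * u ^ p ^ e ∈ Ideal.span ((fun z : (Y'.presheaf.stalk x) => z ^ p ^ e) '' (Ideal.span
    (Set.range s) : Set (Y'.presheaf.stalk x)))) → u ∈ Ideal.span (Set.range s))}.Finite ∧ (∀ x : Y', ¬
    (IsDomain (Y'.presheaf.stalk x) ∧ ∀ d : ℕ, ringKrullDim (Y'.presheaf.stalk x) = d → ∀ s : Fin d →
    (Y'.presheaf.stalk x), (Ideal.span (Set.range s)).radical.IsMaximal → ∀ u c : (Y'.presheaf.stalk x), c ≠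
    0 → (∀ e : ℕ, c * u ^ p ^ e ∈ Ideal.span ((fun z : (Y'.presheaf.stalk x) => z ^ p ^ e) '' (Ideal.span
    (Set.range s) : Set (Y'.presheaf.stalk x)))) → u ∈ Ideal.span (Set.range s)) → ∀ y : Y', y ⤳ x → y ≠ x →
    IsRegularLocalRing (Y'.presheaf.stalk y)) := by
  sorry

/-! ## §1 The local blow-up model at an isolated singular defect germ (PROVED from S1 landed and S2') -/

/-- **Local blow-up certificate at every isolated singularity of dimension ≥ 2 that is a rung-2, non-rung-3
variety germ**: if `R` is a maximal-multiplicity F-pure hypersurface take `I = 𝔪_R` — the blow-up of the closed point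
is pointwise regular-or-certified by the LANDED S1 (`MaxMultiplicityCertificate.stub_maxMultiplicityCertificate`,
p152829; regular ⇒ rung 3 by `Negative.rungThree_of_isRegularLocalRing`); otherwise use S2'. [folklore] -/
theorem local_blowup_model
    (p : ℕ) [Fact p.Prime] (R : Type) [CommRing R] [IsNoetherianRing R] [IsLocalRing R] [IsDomain R] [CharP
    R p] (hgerm : (∃ (k : Type) (_ : Field k) (_ : CharP k p) (Y : Scheme.{0}) (g : Y ⟶ Spec (.of k)) (_ :
    IsSeparated g) (_ : LocallyOfFiniteType g) (_ : QuasiCompact g) (_ : IsIntegral Y) (y : Y), Nonempty (R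
    ≃+* Y.presheaf.stalk y))) (h₂ : (IsDomain R ∧ ∀ d : ℕ, ringKrullDim R = d → ∀ s : Fin d → R, (Ideal.span
    (Set.range s)).radical.IsMaximal → RingTheory.Sequence.IsWeaklyRegular R (List.ofFn s) ∧ ∀ u : R, (∃ e :
    ℕ, u ^ p ^ e ∈ Ideal.span ((fun z : R => z ^ p ^ e) '' (Ideal.span (Set.range s) : Set R))) → u ∈
    Ideal.span (Set.range s))) (h₃ : ¬ (IsDomain R ∧ ∀ d : ℕ, ringKrullDim R = d → ∀ s : Fin d → R,
    (Ideal.span (Set.range s)).radical.IsMaximal → ∀ u c : R, c ≠ 0 → (∀ e : ℕ, c * u ^ p ^ e ∈ Ideal.span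
    ((fun z : R => z ^ p ^ e) '' (Ideal.span (Set.range s) : Set R))) → u ∈ Ideal.span (Set.range s))) (hm :
    IsLocalRing.maximalIdeal R ≠ ⊥) (hdim : (2 : WithBot ℕ∞) ≤ ringKrullDim R) (hreg : (∀ (q : Ideal R)
    [q.IsPrime], q ≠ IsLocalRing.maximalIdeal R → IsRegularLocalRing (Localization.AtPrime q))) : (∃ I :
    Ideal R, I ≤ IsLocalRing.maximalIdeal R ∧ IsLocalRing.maximalIdeal R ≤ I.radical ∧ ∀ w : affineBlowup I,
    (IsDomain ((affineBlowup I).presheaf.stalk w) ∧ ∀ d : ℕ, ringKrullDim ((affineBlowup I).presheaf.stalk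
    w) = d → ∀ s : Fin d → ((affineBlowup I).presheaf.stalk w), (Ideal.span (Set.range s)).radical.IsMaximal
    → ∀ u c : ((affineBlowup I).presheaf.stalk w), c ≠ 0 → (∀ e : ℕ, c * u ^ p ^ e ∈ Ideal.span ((fun z :
    ((affineBlowup I).presheaf.stalk w) => z ^ p ^ e) '' (Ideal.span (Set.range s) : Set ((affineBlowup
    I).presheaf.stalk w)))) → u ∈ Ideal.span (Set.range s)) ∨ (IsDomain (((affineBlowup I).presheaf.stalk
    w)) ∧ ∃ t : ((affineBlowup I).presheaf.stalk w), t ∈ IsLocalRing.maximalIdeal (((affineBlowup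
    I).presheaf.stalk w)) ∧ t ≠ 0 ∧ IsRegularRing (Localization.Away t) ∧ (∀ d : ℕ, ringKrullDim
    (((affineBlowup I).presheaf.stalk w) ⧸ Ideal.span {t}) = d → ∀ s : Fin d → ((affineBlowup
    I).presheaf.stalk w) ⧸ Ideal.span {t}, (Ideal.span (Set.range s)).radical.IsMaximal →
    RingTheory.Sequence.IsWeaklyRegular (((affineBlowup I).presheaf.stalk w) ⧸ Ideal.span {t}) (List.ofFn s)
    ∧ ∀ u : ((affineBlowup I).presheaf.stalk w) ⧸ Ideal.span {t}, (∃ e : ℕ, u ^ p ^ e ∈ Ideal.span ((fun z :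
    ((affineBlowup I).presheaf.stalk w) ⧸ Ideal.span {t} => z ^ p ^ e) '' (Ideal.span (Set.range s) : Set
    (((affineBlowup I).presheaf.stalk w) ⧸ Ideal.span {t})))) → u ∈ Ideal.span (Set.range s)))) := by
  classical
  have hp : p.Prime := Fact.out
  by_cases hhyp : (∃ (S : Type) (_ : CommRing S) (_ : IsRegularLocalRing S) (_ : CharP S p) (n : ℕ) (f : S), ringKrullDim S = ((n + 1 : ℕ) : WithBot ℕ∞) ∧ f ∈ IsLocalRing.maximalIdeal S ^ (n + 1) ∧ f ^ (p - 1) ∉ frobeniusPower p (IsLocalRing.maximalIdeal S) ∧ Nonempty (R ≃+* S ⧸ Ideal.span {f}))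
  · -- S1 (LANDED): one blow-up of the closed point is pointwise certified
    obtain ⟨S, _, _, _, n, f, hSdim, hmult, hF, ⟨e⟩⟩ := hhyp
    refine ⟨IsLocalRing.maximalIdeal R, le_rfl, Ideal.le_radical, fun w => ?_⟩
    -- stalks of the blow-up have characteristic `p` (structure map to `Spec 𝔽_p`)
    haveI : CharP ((affineBlowup (IsLocalRing.maximalIdeal R)).presheaf.stalk w) p :=
      Negative.charP_stalk (affineBlowup.π (IsLocalRing.maximalIdeal R) ≫
        Spec.map (CommRingCat.ofHom (ZMod.castHom (dvd_refl p) R))) w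
    rcases MaxMultiplicityCertificate.stub_maxMultiplicityCertificate p S n f hSdim hmult hF R e hm hreg w
      with hregw | hcert
    · exact Or.inl (Negative.rungThree_of_isRegularLocalRing hp _ hregw)
    · exact Or.inr hcert
  · exact stub_isolatedSingularityBlowupCertificate p R hgerm h₂ h₃ hm hdim hreg hhyp

/-- **Isolated singularities have regular punctured spectra (scheme-to-ring bookkeeping).** If every proper
generization of a point `x` of a scheme has a regular local ring, then every localization of `𝒪_{Y,x}` at a
non-maximal prime is regular: such a prime is the contraction of `𝔪_{x'}` for a generization `x' ⤳ x`, `x' ≠ x`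
(else the prime is `𝔪`), and `(𝒪_{Y,x})_q ≅ 𝒪_{Y,x'}` (Stacks 01J7). [cite: StacksProject, Tag 01J7] -/
theorem isRegularLocalRing_localization_of_generizations {Y : Scheme.{0}} (x : Y)
    (hgen : ∀ y : Y, y ⤳ x → y ≠ x → IsRegularLocalRing (Y.presheaf.stalk y))
    (q : Ideal (Y.presheaf.stalk x)) [q.IsPrime] (hq : q ≠ maximalIdeal (Y.presheaf.stalk x)) :
    IsRegularLocalRing (Localization.AtPrime q) := by
  obtain ⟨x', hx'x, rfl⟩ := exists_specializes_comap_stalkSpecializes_eq x q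
  have hne : x' ≠ x := by
    rintro rfl
    apply hq
    rw [TopCat.Presheaf.stalkSpecializes_refl]
    exact Ideal.comap_id _
  haveI : IsRegularLocalRing (Y.presheaf.stalk x') := hgen x' hx'x hne
  letI := (Y.presheaf.stalkSpecializes hx'x).hom.toAlgebra
  haveI := isLocalizationAtPrime_stalkSpecializes hx'x
  set P := (maximalIdeal (Y.presheaf.stalk x')).comap (Y.presheaf.stalkSpecializes hx'x).hom with hP
  let e : Localization.AtPrime P ≃ₐ[Y.presheaf.stalk x] Y.presheaf.stalk x' :=
    IsLocalization.algEquiv P.primeCompl (Localization.AtPrime P) (Y.presheaf.stalk x')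
  exact IsRegularLocalRing.of_ringEquiv e.toRingEquiv.symm

/-! ## §2 The finite-defect globaliser — LANDED

`FiniteDefectGlobal.rungThreeModel_of_finiteDefect` (tree
`Theorems/FrobeniusLadderFRationalModificationFiniteDefectGlobal.lean`, p160614, lead a1): finite defect ⇒ rung-3
model from local 𝔪-primary blow-up certificates at the defect points of dimension ≥ 2, with closedness of the defect
points (`isClosed_singleton_of_finite_defect`) and rung 3 on punctured spectra
(`rungThree_localization_of_finite_defect`) DERIVED; curves by normalisation. -/

/-! ## §3 The composition: the crux BY NAME, sorry-free modulo the two stubs -/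

/-- **Line `socle-discrepancy-certificate` (v3) closes the crux modulo its stubs.** By the plain integral form of
the crux (`IntegralForm.fRationalModification_iff_integral`, p131587) it suffices to treat an integral rung-2 `Y`:
isolate the defect (S4'), apply the finite-defect globaliser to the isolated model with the local blow-up
certificates of §1, and compose the two proper birational morphisms. -/
theorem FRationalModification_of : FRationalModification :=
  IntegralForm.fRationalModification_iff_integral.mpr fun p hp k _ _ Y g hsep hft hqc hY h₂ => by
    haveI : Fact p.Prime := ⟨hp⟩
    haveI := hsep; haveI := hft; haveI := hqc; haveI := hY
    -- S4': isolate the defect by a rung-2-preserving proper birational modification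
    obtain ⟨Y', ρ, hρ, hρbir, hY', h₂', hfin, hiso⟩ := stub_isolateDefect p k Y g h₂
    haveI := hρ; haveI := hY'
    haveI : IsLocallyNoetherian Y' := LocallyOfFiniteType.isLocallyNoetherian (ρ ≫ g)
    -- the finite-defect globaliser, fed with the local blow-up certificates of §1 at the defect points
    obtain ⟨Y₂, π, hπ, hπbir, h₃⟩ := FiniteDefectGlobal.rungThreeModel_of_finiteDefect p k Y' (ρ ≫ g) hfin
      (fun x hx hdim _hpunc => by
        haveI := Negative.charP_stalk (ρ ≫ g) x
        haveI : IsDomain (Y'.presheaf.stalk x) := (h₂' x).1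
        have hm : maximalIdeal (Y'.presheaf.stalk x) ≠ ⊥ := by
          intro hbot
          apply hx
          have hfield : IsField (Y'.presheaf.stalk x) := IsLocalRing.isField_iff_maximalIdeal_eq.mpr hbot
          letI := hfield.toField
          exact Negative.rungThree_of_isRegularLocalRing hp _ inferInstance
        exact local_blowup_model p (Y'.presheaf.stalk x)
          ⟨k, inferInstance, inferInstance, Y', ρ ≫ g, inferInstance, inferInstance, inferInstance, inferInstance,
            x, ⟨RingEquiv.refl _⟩⟩
          (h₂' x) hx hm hdim
          (fun q _ hq => isRegularLocalRing_localization_of_generizations x (hiso x hx) q hq))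
    -- compose
    haveI := hπ
    exact ⟨Y₂, π ≫ ρ, inferInstance, ComponentGluing.IsBirational.comp hπbir hρbir, h₃⟩

end Summit.ResolutionOfSingularities.ResolutionOfSingularities.Cruxes.FRationalModification.Lines.SocleDiscrepancyCertificate

end
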